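import Literature.MathematicalPhysics.QuantumLattice.KomaPiFluxKomaTasakiSystem
import Mathlib.Analysis.InnerProductSpace.Trace
import HarnessLib

/-!
# A tracial ground-state average is attained by a ground state in a symmetry sector;
# an `η`-pairing long-range-ordered ground EIGENSTATE of Koma's `π`-flux BCS model

The Koma–Tasaki theorems on obscured symmetry breaking ([KomaTasaki1994] §2, [KomaTasaki1993] §7; tree
files `KomaTasakiSSB*.lean`, `KomaTasakiU1FieldBound.lean`) start from ONE eigenstate `Φ` of the Hamiltonian
AND of the `U(1)` charge carrying long-range order `⟨Φ,(O)²Φ⟩ ≥ (μoN)²` (hypothesis iv) (2.17)).  Reflection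
positivity, on the other hand, delivers long-range order of the TRACIAL ground state `ω_GS = tr(P₀ ·)/tr P₀`
(the uniform mixture of all ground states; for Koma's model: `KomaPiFlux.groundState_superconductingOrder_coulomb`,
[Koma2022] Theorem 2.1 with (2.13)).  This file bridges the two:

* **`Matrix.exists_groundState_eigenvector_re_ge`** (general, finite-dimensional): for commuting Hermitian
  matrices `A` (the Hamiltonian) and `N` (a conserved charge) and ANY matrix `O`, some unit vector `Φ` of the
  ground space of `A` which is an eigenvector of `N` has `Re Φ†OΦ ≥ Re ω_GS(O)`.  Proof: `N` preserves the ground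
  space `G` of `A` and is Hermitian on it, so `G` has an orthonormal basis `(e_i)` of `N`-eigenvectors
  (`LinearMap.IsSymmetric.eigenvectorBasis` of the restriction); `tr(P₀O) = Σ_i ⟨e_i, O e_i⟩` and `tr P₀ = dim G`
  (`trace_projMatrix_mul_eq_sum`, from `OrthonormalBasis.starProjection_eq_sum_rankOne` and
  `InnerProductSpace.trace_rankOne`), so the average `ω_GS(O)` is at most the largest `Re⟨e_i, Oe_i⟩`.
  [Tasaki2020, §2.1 and App. A (ground states, symmetry sectors)]
* **`KomaPiFlux.exists_lro_groundState_coulomb`** — for Koma's model in Lieb's frame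
  (`hamiltonianC κ U g g' 0 0`, `D = d+1 ≥ 3`, `g > 0`, `|κ| ≤ g/1000`, `0 ≤ g' ≤ g/2000`, `U + 2gD ≤ 0`) on every
  torus of side `2k`, `k ≥ k₀`: a unit ground state `Φ`, eigenvector of the particle number, with
  `Re Φ†(Σ_xΓ¹_x)²Φ ≥ |Λ|²/2000` — hypothesis iv) of Koma–Tasaki for the instance `KomaPiFlux.ktSystem`
  (`KomaPiFluxKomaTasakiSystem.lean`), feeding KT93 Theorem 7.3 (`KomaPiFluxSpontaneousOrder.lean`);
  `KomaPiFlux.exists_lro_groundState` is the `g' = 0` case.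

All statements are proved; no named facts.

## References

* [Tasaki2020] H. Tasaki, *Physics and Mathematics of Quantum Many-Body Systems*, Springer 2020, §2.1, App. A.
* [KomaTasaki1994] T. Koma, H. Tasaki, J. Stat. Phys. 76 (1994) 745–803, §2.3 iv) (2.17).
* [KomaTasaki1993] T. Koma, H. Tasaki, Commun. Math. Phys. 158 (1993) 191–214, §7 (7.1), Theorem 7.3.
* [Koma2022] T. Koma, arXiv:2201.13135, Theorem 2.1, (2.13), (6.18).
-/

noncomputable section

namespace Literature.MathematicalPhysics.QuantumLattice

open _root_.Matrix Finset Filter Topology WithLp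
open scoped Matrix.Norms.L2Operator InnerProductSpace ComplexConjugate ComplexOrder

/-! ### The general lemma -/

section General

variable {n : Type*} [Fintype n] [DecidableEq n]

/-- The trace of a matrix is the trace of the operator it defines on `EuclideanSpace ℂ n`.
[cite: Tasaki2020, App. A.2] -/
theorem _root_.Matrix.trace_eq_trace_toEuclideanCLM (M : Matrix n n ℂ) :
    M.trace = LinearMap.trace ℂ (EuclideanSpace ℂ n)
      ((toEuclideanCLM (n := n) (𝕜 := ℂ) M : EuclideanSpace ℂ n →L[ℂ] EuclideanSpace ℂ n) :
        EuclideanSpace ℂ n →ₗ[ℂ] EuclideanSpace ℂ n) := by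
  rw [coe_toEuclideanCLM_eq_toEuclideanLin, toEuclideanLin_eq_toLin_orthonormal, Matrix.trace_toLin_eq]

/-- **`tr(P_K O) = Σ_i ⟨e_i, O e_i⟩`** for the projection matrix onto a subspace `K ≤ ℂⁿ` and any orthonormal
basis `(e_i)` of `K`. [cite: Tasaki2020, App. A.2] -/
theorem trace_projMatrix_mul_eq_sum {ι : Type*} [Fintype ι] (K : Submodule ℂ (EuclideanSpace ℂ n))
    (b : OrthonormalBasis ι ℂ K) (O : Matrix n n ℂ) :
    (projMatrix K * O).trace =
      ∑ i, ⟪(b i : EuclideanSpace ℂ n), toEuclideanCLM (n := n) (𝕜 := ℂ) O (b i : EuclideanSpace ℂ n)⟫_ℂ := by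
  have hP : toEuclideanCLM (n := n) (𝕜 := ℂ) (projMatrix K) = K.starProjection := by
    rw [projMatrix, StarAlgEquiv.apply_symm_apply]
  rw [Matrix.trace_eq_trace_toEuclideanCLM, map_mul, hP, b.starProjection_eq_sum_rankOne, Finset.sum_mul,
    ContinuousLinearMap.toLinearMap_sum, map_sum]
  refine Finset.sum_congr rfl fun i _ => ?_
  rw [ContinuousLinearMap.mul_def, InnerProductSpace.rankOne_comp, InnerProductSpace.trace_rankOne,
    ContinuousLinearMap.adjoint_inner_left]

omit [DecidableEq n] in
/-- `‖v‖² = v†v` on `EuclideanSpace` (as a complex number). [cite: Tasaki2020, App. A.2] -/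
theorem star_ofLp_dotProduct_ofLp (v : EuclideanSpace ℂ n) :
    star (ofLp v) ⬝ᵥ ofLp v = ((‖v‖ ^ 2 : ℝ) : ℂ) := by
  rw [dotProduct_comm, ← EuclideanSpace.inner_eq_star_dotProduct, inner_self_eq_norm_sq_to_K]
  norm_cast

/-- `⟨v, (toEuclideanCLM O) v⟩ = v† O v`. [cite: Tasaki2020, App. A.2] -/
theorem inner_toEuclideanCLM_eq_dotProduct (O : Matrix n n ℂ) (v : EuclideanSpace ℂ n) :
    ⟪v, toEuclideanCLM (n := n) (𝕜 := ℂ) O v⟫_ℂ = star (ofLp v) ⬝ᵥ (O *ᵥ ofLp v) := by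
  rw [EuclideanSpace.inner_eq_star_dotProduct, ofLp_toEuclideanCLM, dotProduct_comm]

/-- **A tracial ground-state average is attained or exceeded by a ground state in a symmetry sector.**
For commuting Hermitian `A`, `N` on a nonempty index type and any matrix `O` there is a unit vector `Φ` with
`AΦ = E₀Φ` (`E₀ = groundEnergy A`), `NΦ = νΦ` for a real `ν`, and `Re ω_GS(O) ≤ Re Φ†OΦ`, where
`ω_GS = groundStateFunctional A` is the uniform mixture of the ground states.  (Ground states can be chosen in
the symmetry sectors of a conserved charge; an average over an orthonormal basis is at most its largest term.)
[cite: Tasaki2020, §2.1 (symmetry and ground states), App. A.2] -/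
theorem _root_.Matrix.exists_groundState_eigenvector_re_ge [Nonempty n] {A N : Matrix n n ℂ}
    (hA : A.IsHermitian) (hN : N.IsHermitian) (hAN : A * N = N * A) (O : Matrix n n ℂ) :
    ∃ Φ : n → ℂ, star Φ ⬝ᵥ Φ = 1 ∧ A *ᵥ Φ = (A.groundEnergy : ℂ) • Φ ∧
      (∃ ν : ℝ, N *ᵥ Φ = (ν : ℂ) • Φ) ∧ (A.groundStateFunctional O).re ≤ (star Φ ⬝ᵥ (O *ᵥ Φ)).re := by
  -- the Euclidean copy `K` of the ground space, `P₀ = projMatrix K`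
  set K : Submodule ℂ (EuclideanSpace ℂ n) :=
    A.groundSpace.map ((WithLp.linearEquiv 2 ℂ (n → ℂ)).symm : (n → ℂ) →ₗ[ℂ] EuclideanSpace ℂ n) with hK
  have hPK : A.groundProj = projMatrix K := groundProj_eq A
  have hmemK : ∀ v : EuclideanSpace ℂ n, v ∈ K ↔ (ofLp v : n → ℂ) ∈ A.groundSpace := by
    intro v
    rw [hK, Submodule.mem_map]
    constructor
    · rintro ⟨u, hu, huv⟩
      rw [← huv]
      exact hu
    · intro hv
      exact ⟨ofLp v, hv, rfl⟩
  -- `N` restricted to `K` is a symmetric operator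
  set TN : EuclideanSpace ℂ n →ₗ[ℂ] EuclideanSpace ℂ n :=
    ((toEuclideanCLM (n := n) (𝕜 := ℂ) N : EuclideanSpace ℂ n →L[ℂ] EuclideanSpace ℂ n) :
      EuclideanSpace ℂ n →ₗ[ℂ] EuclideanSpace ℂ n) with hTN_def
  have hTN_apply : ∀ v : EuclideanSpace ℂ n, ofLp (TN v) = N *ᵥ ofLp v := fun v => rfl
  have hTN : ∀ v ∈ K, TN v ∈ K := by
    intro v hv
    rw [hmemK] at hv ⊢
    rw [hTN_apply]
    exact mulVec_mem_groundSpace_of_commute hAN.symm hv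
  have hsym : TN.IsSymmetric :=
    ContinuousLinearMap.isSelfAdjoint_iff_isSymmetric.mp ((Matrix.isSelfAdjoint_toEuclideanCLM_iff N).mpr hN)
  have hsymK := hsym.restrict_invariant hTN
  -- `K ≠ ⊥`, `m = dim K ≥ 1`
  have hKne : K ≠ ⊥ := by
    intro hbot
    apply groundSpace_ne_bot_holds hA
    rw [Submodule.eq_bot_iff] at hbot ⊢
    intro v hv
    have h := hbot (toLp 2 v) ((hmemK _).2 hv)
    have h' := congrArg ofLp h
    simpa using h'
  set m : ℕ := Module.finrank ℂ K with hm_def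
  have hm0 : m ≠ 0 := fun h => hKne (Submodule.finrank_eq_zero.1 h)
  have hmpos : (0 : ℝ) < m := by exact_mod_cast Nat.pos_of_ne_zero hm0
  -- an orthonormal basis of `K` of `N`-eigenvectors
  set b := hsymK.eigenvectorBasis rfl with hb_def
  -- the trace identities
  have htrO : (A.groundProj * O).trace =
      ∑ i, ⟪(b i : EuclideanSpace ℂ n), toEuclideanCLM (n := n) (𝕜 := ℂ) O (b i : EuclideanSpace ℂ n)⟫_ℂ := by
    rw [hPK]; exact trace_projMatrix_mul_eq_sum K b O
  have hnorm : ∀ i, ‖(b i : EuclideanSpace ℂ n)‖ = 1 := fun i => by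
    have h1 : ‖b i‖ = 1 := b.orthonormal.1 i
    exact h1
  have htr1 : A.groundProj.trace = (m : ℂ) := by
    have h := trace_projMatrix_mul_eq_sum K b 1
    rw [Matrix.mul_one, map_one] at h
    rw [hPK, h]
    simp only [ContinuousLinearMap.one_def, ContinuousLinearMap.coe_id', id_eq, inner_self_eq_norm_sq_to_K, hnorm,
      Finset.sum_const, Finset.card_univ, Fintype.card_fin, hm_def]
    simp
  -- the average
  have havg : (A.groundStateFunctional O).re * m =
      ∑ i, (⟪(b i : EuclideanSpace ℂ n), toEuclideanCLM (n := n) (𝕜 := ℂ) O (b i : EuclideanSpace ℂ n)⟫_ℂ).re := by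
    rw [groundStateFunctional_apply, htr1, htrO, ← Complex.re_sum]
    have hmC : (m : ℂ) ≠ 0 := by exact_mod_cast hm0
    have : ((m : ℂ)⁻¹ * ∑ i, ⟪(b i : EuclideanSpace ℂ n), toEuclideanCLM (n := n) (𝕜 := ℂ) O (b i : EuclideanSpace ℂ n)⟫_ℂ).re =
        (∑ i, ⟪(b i : EuclideanSpace ℂ n), toEuclideanCLM (n := n) (𝕜 := ℂ) O (b i : EuclideanSpace ℂ n)⟫_ℂ).re / m := by
      rw [mul_comm, ← div_eq_mul_inv]
      exact Complex.div_natCast_re _ m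
    rw [this, div_mul_cancel₀ _ hmpos.ne']
  -- pigeonhole
  obtain ⟨i, -, hi⟩ : ∃ i ∈ (Finset.univ : Finset (Fin m)), (A.groundStateFunctional O).re ≤
      (⟪(b i : EuclideanSpace ℂ n), toEuclideanCLM (n := n) (𝕜 := ℂ) O (b i : EuclideanSpace ℂ n)⟫_ℂ).re := by
    refine Finset.exists_le_of_sum_le ⟨⟨0, Nat.pos_of_ne_zero hm0⟩, Finset.mem_univ _⟩ (le_of_eq ?_)
    rw [Finset.sum_const, Finset.card_univ, Fintype.card_fin, nsmul_eq_mul, mul_comm, havg]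
  -- the vector
  have hbi_eig : TN (b i : EuclideanSpace ℂ n) = ((hsymK.eigenvalues rfl i : ℝ) : ℂ) • (b i : EuclideanSpace ℂ n) := by
    have h := hsymK.apply_eigenvectorBasis rfl i
    rw [← hb_def] at h
    have h' := congrArg (fun w : K => (w : EuclideanSpace ℂ n)) h
    simp only [LinearMap.coe_restrict_apply, Submodule.coe_smul] at h'
    exact h'
  refine ⟨ofLp (b i : EuclideanSpace ℂ n), ?_, ?_, ⟨hsymK.eigenvalues rfl i, ?_⟩, ?_⟩
  · rw [star_ofLp_dotProduct_ofLp, hnorm, one_pow, Complex.ofReal_one]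
  · exact (mem_groundSpace_iff A _).1 ((hmemK _).1 (b i).2)
  · rw [← hTN_apply, hbi_eig, WithLp.ofLp_smul]
  · rw [← inner_toEuclideanCLM_eq_dotProduct]
    exact hi

end General

/-! ### Koma's model: a long-range-ordered ground eigenstate in a particle-number sector -/

namespace KomaPiFlux

attribute [local instance] LiebCutRP.decEqTorus

open HubbardWave0 PairHopRP FermionTorus LiebCutRP

variable {d L : ℕ} [NeZero L]

omit [NeZero L] in
/-- `groundLroSq H = Re ω_GS((Σ_xΓ¹_x)²)/|Λ|²`. [cite: Koma2022, (2.13), (6.18)–(6.19)] -/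
theorem groundLroSq_eq (H : Matrix (Finset (Orb (FermionTorus (d + 1) L))) (Finset (Orb (FermionTorus (d + 1) L))) ℂ) :
    groundLroSq H = (H.groundStateFunctional ((∑ x : FermionTorus (d + 1) L, gammaOne x) *
        (∑ x : FermionTorus (d + 1) L, gammaOne x))).re / (Fintype.card (FermionTorus (d + 1) L) : ℝ) ^ 2 := by
  rw [groundLroSq, Finset.sum_mul_sum, map_sum, Complex.re_sum]
  congr 1
  refine Finset.sum_congr rfl fun x _ => ?_
  rw [map_sum, Complex.re_sum]

/-- **From the tracial ground state to an eigenstate**: if `groundLroSq H ≥ a` for a Hermitian `H` conserving the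
particle number, then some unit ground state `Φ` of `H` in a particle-number sector has
`Re Φ†(Σ_xΓ¹_x)²Φ ≥ a|Λ|²`. [cite: Tasaki2020, §2.1] [cite: KomaTasaki1994, §2.3 iv) (2.17)] -/
theorem exists_groundState_eigenvector_of_groundLroSq
    {H : Matrix (Finset (Orb (FermionTorus (d + 1) L))) (Finset (Orb (FermionTorus (d + 1) L))) ℂ}
    (hH : H.IsHermitian) (hHN : Commute totalNumber H) {a : ℝ} (ha : a ≤ groundLroSq H) :
    ∃ Φ : Finset (Orb (FermionTorus (d + 1) L)) → ℂ, star Φ ⬝ᵥ Φ = 1 ∧ H *ᵥ Φ = (H.groundEnergy : ℂ) • Φ ∧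
      (∃ ν : ℝ, totalNumber *ᵥ Φ = (ν : ℂ) • Φ) ∧
      a * (Fintype.card (FermionTorus (d + 1) L) : ℝ) ^ 2 ≤
        (star Φ ⬝ᵥ ((∑ x : FermionTorus (d + 1) L, gammaOne x) *ᵥ
          ((∑ x : FermionTorus (d + 1) L, gammaOne x) *ᵥ Φ))).re := by
  obtain ⟨Φ, hΦ, hHΦ, hNΦ, hO⟩ := Matrix.exists_groundState_eigenvector_re_ge hH totalNumber_isHermitian hHN.eq.symm
    ((∑ x : FermionTorus (d + 1) L, gammaOne x) * (∑ x : FermionTorus (d + 1) L, gammaOne x))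
  refine ⟨Φ, hΦ, hHΦ, hNΦ, ?_⟩
  have hcard : (0 : ℝ) < (Fintype.card (FermionTorus (d + 1) L) : ℝ) ^ 2 := by
    have : 0 < Fintype.card (FermionTorus (d + 1) L) := Fintype.card_pos
    positivity
  rw [groundLroSq_eq, le_div_iff₀ hcard] at ha
  rw [← mulVec_mulVec] at hO
  exact ha.trans hO

/-- **An `η`-pairing long-range-ordered ground EIGENSTATE of Koma's model, with the Coulomb term.** In
`D = d+1 ≥ 3` directions, for `g > 0`, `|κ| ≤ g/1000`, `0 ≤ g' ≤ g/2000`, `U + 2gD ≤ 0` there is `k₀` such that on every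
torus of side `2k`, `k ≥ k₀`, some unit ground state `Φ` of `H = hamiltonianC κ U g g' 0 0`, lying in a particle-number
sector, has `Re Φ†(Σ_xΓ¹_x)²Φ ≥ |Λ|²/2000` — hypothesis iv) (2.17) of Koma–Tasaki with `μo = 1/√2000`.
[cite: Koma2022, Theorem 2.1, (2.13)] [cite: KomaTasaki1994, §2.3 iv) (2.17)] -/
theorem exists_lro_groundState_coulomb (hd : 2 ≤ d) {κ U g g' : ℝ} (hg : 0 < g) (hκg : |κ| ≤ g / 1000)
    (hg'0 : 0 ≤ g') (hg'g : g' ≤ g / 2000) (hU : U + 2 * g * (d + 1) ≤ 0) :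
    ∃ k₀ : ℕ, ∀ k : ℕ, k₀ ≤ k → ∀ [NeZero (2 * k)],
      ∃ Φ : Finset (Orb (FermionTorus (d + 1) (2 * k))) → ℂ, star Φ ⬝ᵥ Φ = 1 ∧
        hamiltonianC κ U g g' (fun (_ _ : FermionTorus (d + 1) (2 * k)) => (0 : ℝ)) 0 *ᵥ Φ =
          ((hamiltonianC κ U g g' (fun (_ _ : FermionTorus (d + 1) (2 * k)) => (0 : ℝ)) 0).groundEnergy : ℂ) • Φ ∧
        (∃ ν : ℝ, totalNumber *ᵥ Φ = (ν : ℂ) • Φ) ∧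
        (1 / 2000 : ℝ) * (Fintype.card (FermionTorus (d + 1) (2 * k)) : ℝ) ^ 2 ≤
          (star Φ ⬝ᵥ ((∑ x : FermionTorus (d + 1) (2 * k), gammaOne x) *ᵥ
            ((∑ x : FermionTorus (d + 1) (2 * k), gammaOne x) *ᵥ Φ))).re := by
  obtain ⟨k₀, hk₀⟩ := groundState_superconductingOrder_coulomb hd hg hκg hg'0 hg'g hU
  refine ⟨k₀, fun k hk _ => ?_⟩
  exact exists_groundState_eigenvector_of_groundLroSq (hamiltonianC_isHermitian κ U g g' _ 0)
    (PairHopRP.commute_totalNumber_hamiltonianC_zero (G d (2 * k)) (piFluxAmpl κ) U g g') (hk₀ k hk)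

/-- **An `η`-pairing long-range-ordered ground eigenstate of Koma's model** (`g' = 0`). [cite: Koma2022, Theorem 2.1, (2.13)] [cite: KomaTasaki1994, §2.3 iv) (2.17)] -/
theorem exists_lro_groundState (hd : 2 ≤ d) {κ U g : ℝ} (hg : 0 < g) (hκg : |κ| ≤ g / 1000)
    (hU : U + 2 * g * (d + 1) ≤ 0) :
    ∃ k₀ : ℕ, ∀ k : ℕ, k₀ ≤ k → ∀ [NeZero (2 * k)],
      ∃ Φ : Finset (Orb (FermionTorus (d + 1) (2 * k))) → ℂ, star Φ ⬝ᵥ Φ = 1 ∧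
        hamiltonian κ U g (fun (_ _ : FermionTorus (d + 1) (2 * k)) => (0 : ℝ)) 0 *ᵥ Φ =
          ((hamiltonian κ U g (fun (_ _ : FermionTorus (d + 1) (2 * k)) => (0 : ℝ)) 0).groundEnergy : ℂ) • Φ ∧
        (∃ ν : ℝ, totalNumber *ᵥ Φ = (ν : ℂ) • Φ) ∧
        (1 / 2000 : ℝ) * (Fintype.card (FermionTorus (d + 1) (2 * k)) : ℝ) ^ 2 ≤
          (star Φ ⬝ᵥ ((∑ x : FermionTorus (d + 1) (2 * k), gammaOne x) *ᵥ
            ((∑ x : FermionTorus (d + 1) (2 * k), gammaOne x) *ᵥ Φ))).re := by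
  obtain ⟨k₀, hk₀⟩ := exists_lro_groundState_coulomb hd hg hκg le_rfl (by positivity) hU
  refine ⟨k₀, fun k hk _ => ?_⟩
  have h := hk₀ k hk
  rwa [hamiltonianC_zero] at h

end KomaPiFlux

end Literature.MathematicalPhysics.QuantumLattice

end
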